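import Literature.Analysis.FluidPDE.NSSereginMildStability
import Literature.Analysis.FluidPDE.CKNEpsilonRegularityHolds
import Literature.Analysis.FluidPDE.PressureDecayEstimateProofs
import Literature.Analysis.FluidPDE.LocalLerayPressureBoundHolds
import HarnessLib

/-!
# Stability of a singular point at the final time — discharged

Analysis/FluidPDE glue file (one theorem, no definitions, no named facts) **discharging the named
fact `Literature.Analysis.FluidPDE.lemarieRieusset_singular_point_stability`**
(`NSSereginMildFacts.lean`; P. G. Lemarié-Rieusset, *The Navier–Stokes Problem in the 21st
Century*, CRC Press 2016, proof of Thm. 15.5, PDF pp. 571–573, (15.5)–(15.6) with the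
ε-regularity criterion Thm. 14.4; interior form: Rusin–Šverák 2011, Lemma 2.1): if local Leray
solutions `v_n → v_∞` in `L²_loc` on a slab with uniform uniformly-local energy bounds and `v_∞`
is bounded on a backward cylinder `Q_{r₀}(T, x₀)`, then the `v_n` are bounded on some
`Q_{r₁}(T, x₀)` for all large `n`.

The accepted tree reduction is `lemarieRieusset_singular_point_stability_of_facts`
(`NSSereginMildStability.lean`, general viscosity by time rescaling from the unit-viscosity
statement `singular_point_stability_unit` of `NSSereginMildStabilityCore.lean`), which takes
three named facts as hypotheses; all three are discharged in the tree:

* `lemarieRieusset_epsilon_regularity_holds` (`CKNEpsilonRegularityHolds.lean`: Thm. 14.4, from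
  Robinson–Rodrigo–Sadowski 2016, Thm. 15.3 with force, fully proved);
* `seregin_sverak_pressure_decay_holds` (`PressureDecayEstimateProofs.lean`: Seregin–Šverák
  2009, (as13), ball form);
* `kangMiuraTsai_local_pressure_bound_holds` (`LocalLerayPressureBoundHolds.lean`:
  Kang–Miura–Tsai 2021, Lemma 3.4 / §8).

Hence `lemarieRieusset_singular_point_stability_holds`, unconditionally. This file cannot be
appended to `NSSereginMildFacts.lean` itself (the reduction imports that file), whence the
separate leaf module, as for `CKNEpsilonRegularityHolds.lean`.

## References

* P. G. Lemarié-Rieusset, *The Navier–Stokes Problem in the 21st Century*, CRC Press (2016),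
  doi:10.1201/b19556: proof of Thm. 15.5, PDF pp. 571–573, (15.5)–(15.6); Thm. 14.4 (p. 505).
  [`LemarieRieusset2016`]
* W. Rusin, V. Šverák, *Minimal initial data for potential Navier–Stokes singularities*,
  J. Funct. Anal. 260 (2011) = arXiv:0911.0500, Lemma 2.1. [`RusinSverak2011`]
-/

noncomputable section

namespace Literature.Analysis.FluidPDE

/-- **Lemarié-Rieusset's stability of a singular point at the final time, proved**: the named
fact `lemarieRieusset_singular_point_stability` (proof of Thm. 15.5, pp. 571–573, (15.5)–(15.6)
with Thm. 14.4) holds, by the accepted reduction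
`lemarieRieusset_singular_point_stability_of_facts` fed with the three discharged facts
`lemarieRieusset_epsilon_regularity_holds`, `seregin_sverak_pressure_decay_holds`,
`kangMiuraTsai_local_pressure_bound_holds`. [cite: LemarieRieusset2016, proof of Thm. 15.5, pp. 571–573 (15.5)–(15.6) (with Thm. 14.4)] -/
theorem lemarieRieusset_singular_point_stability_holds : lemarieRieusset_singular_point_stability :=
  lemarieRieusset_singular_point_stability_of_facts lemarieRieusset_epsilon_regularity_holds
    seregin_sverak_pressure_decay_holds kangMiuraTsai_local_pressure_bound_holds

end Literature.Analysis.FluidPDE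

end
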